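import Literature.NumberTheory.DiophantineGeometry.AbcShapeReduction
import HarnessLib

/-!
# Reduction of `N_λ(X)` to the shape counts `B_d`: the count (Bernert–Browning–Lichtman–Teräväinen, Prop. 2.1)

The counting half of [BernertEtAl2024, §2, Prop. 2.1] (classes, shapes and admissibility are in
`AbcShapeReduction`): every abc triple of exponent `λ` up to `X` falls into one of at most
`#classRange ε X = (⌊log₂ X⌋ + 1)^{3M+1} ⌊X^{ε/2}⌋³` classes, and within a class the triples inject
into the solutions counted by the `B_M(c; X, Y, Z)` of the class, whose data are admissible at
the dyadic scale `C₀ = 2^k ≤ X`. Hence (`abcExponentCount_le_of_shapeCount_le`):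

> if `B_M(c; X, Y, Z) ≤ K · C₀^θ` for all admissible data, then
> `N_λ(X) ≤ K · #classRange ε X · X^θ` for every `X`,

and `#classRange ε X ≪_{ε,δ} X^{3ε/2 + δ}` (`card_classRange_le`), which is the
"`S*(X) ≪_ε X^ε B_d`, `N_λ(X) ≪ (log X)^4 max S*`" of the source ((2.1)–(2.2), Prop. 2.1) in one
step. Theorems 1.2/1.3 of the source (named facts of `AbcExceptionalSetBounds`) are NOT proved
here; this is their common first step.

## References

* [BernertEtAl2024] C. Bernert, T. Browning, J. D. Lichtman, J. Teräväinen, *Bounds on the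
  exceptional set in the abc conjecture*, arXiv:2410.12234, §2, Proposition 2.1 (v1 and v2).
-/

noncomputable section

open Finset

namespace Literature.NumberTheory.DiophantineGeometry

namespace AbcShapes

/-! ### The range of classes at level `X` -/

/-- The finite set of possible classes of abc triples with `c ≤ X`: scale `k ≤ log₂ X`,
cofactors `1 ≤ cᵢ ≤ ⌊X^{ε/2}⌋`, dyadic exponents `≤ log₂ X`. [cite: BernertEtAl2024, Proposition 2.1] -/
def classRange (ε : ℝ) (X : ℕ) :
    Finset (ℕ × (ℕ × ℕ × ℕ) ×
      ((Fin (numShapes ε) → ℕ) × (Fin (numShapes ε) → ℕ) × (Fin (numShapes ε) → ℕ))) :=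
  range (Nat.log 2 X + 1) ×ˢ
    ((Icc 1 ⌊(X : ℝ) ^ (ε / 2)⌋₊ ×ˢ Icc 1 ⌊(X : ℝ) ^ (ε / 2)⌋₊ ×ˢ Icc 1 ⌊(X : ℝ) ^ (ε / 2)⌋₊) ×ˢ
      (Fintype.piFinset (fun _ : Fin (numShapes ε) => range (Nat.log 2 X + 1)) ×ˢ
        Fintype.piFinset (fun _ : Fin (numShapes ε) => range (Nat.log 2 X + 1)) ×ˢ
        Fintype.piFinset (fun _ : Fin (numShapes ε) => range (Nat.log 2 X + 1))))

/-- `#classRange ε X = (⌊log₂ X⌋ + 1) · ⌊X^{ε/2}⌋³ · (⌊log₂ X⌋ + 1)^{3M}`. [folklore] -/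
theorem card_classRange (ε : ℝ) (X : ℕ) :
    (classRange ε X).card =
      (Nat.log 2 X + 1) * ⌊(X : ℝ) ^ (ε / 2)⌋₊ ^ 3 * (Nat.log 2 X + 1) ^ (3 * numShapes ε) := by
  simp only [classRange, card_product, Fintype.card_piFinset, Nat.card_Icc, card_range, prod_const,
    card_univ, Fintype.card_fin, add_tsub_cancel_right]
  ring

/-- The class of an abc triple with `c ≤ X` lies in `classRange ε X`. [cite: BernertEtAl2024, Proposition 2.1] -/
theorem tripleClass_mem_classRange {ε : ℝ} (hε : 0 < ε) (hε2 : ε < 1 / 2) {t : ℕ × ℕ × ℕ}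
    (ht : IsABCTriple t.1 t.2.1 t.2.2) {X : ℕ} (hX : t.2.2 ≤ X) :
    tripleClass ε t ∈ classRange ε X := by
  obtain ⟨a, b, c⟩ := t
  obtain ⟨ha, hb, habc, -⟩ := ht
  simp only at ha hb habc hX
  have hc : 0 < c := by omega
  obtain ⟨hca, hxa, hfa, hcale, -⟩ := fac_toFin_spec hε hε2 ha
  obtain ⟨hcb, hxb, hfb, hcble, -⟩ := fac_toFin_spec hε hε2 hb
  obtain ⟨hcc, hxc, hfc, hccle, -⟩ := fac_toFin_spec hε hε2 hc
  have haX : a ≤ X := by omega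
  have hbX : b ≤ X := by omega
  -- cofactors `≤ ⌊X^{ε/2}⌋`
  have hcof : ∀ {n : ℕ} {m : ℕ}, (m : ℝ) ≤ (n : ℝ) ^ (ε / 2) → n ≤ X → m ≤ ⌊(X : ℝ) ^ (ε / 2)⌋₊ :=
    fun hm hn => Nat.le_floor (hm.trans (Real.rpow_le_rpow (by positivity) (by exact_mod_cast hn)
      (by positivity)))
  -- shape variables `≤ X`, hence exponents `≤ log₂ X`
  have hexp : ∀ {n : ℕ} (hn : 0 < n), n ≤ X → ∀ i,
      Nat.log 2 (toFin (numShapes ε) (fac ε n).2 i) < Nat.log 2 X + 1 := by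
    intro n hn hnX i
    obtain ⟨hcn, hxn, hfn, -, -⟩ := fac_toFin_spec hε hε2 hn
    have h1 : toFin (numShapes ε) (fac ε n).2 i ≤ n := by
      calc toFin (numShapes ε) (fac ε n).2 i ≤ shapeVal (toFin (numShapes ε) (fac ε n).2) :=
            le_shapeVal hxn i
        _ ≤ (fac ε n).1 * shapeVal (toFin (numShapes ε) (fac ε n).2) := Nat.le_mul_of_pos_left _ hcn
        _ = n := hfn
    exact Nat.lt_succ_of_le (Nat.log_mono_right (h1.trans hnX))
  simp only [classRange, tripleClass, tripleShapes, mem_product, mem_range, mem_Icc,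
    Fintype.mem_piFinset]
  refine ⟨Nat.lt_succ_of_le (Nat.log_mono_right hX), ⟨⟨hca, hcof hcale haX⟩, ⟨hcb, hcof hcble hbX⟩,
    ⟨hcc, hcof hccle hX⟩⟩, fun i => hexp ha haX i, fun i => hexp hb hbX i, fun i => hexp hc hX i⟩

/-! ### The count -/

/-- **Reduction of `N_λ(X)` to the shape counts** [BernertEtAl2024, Prop. 2.1 with (2.1)–(2.2)]:
if `B_M(c; X, Y, Z) ≤ K · C₀^θ` for all data admissible for exponent `l` at scale `C₀`
(`AbcShapes.Admissible`, `M = ⌊10/ε²⌋`), then `N_l(X) ≤ K · #classRange ε X · X^θ` for all `X`.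
Proof: fibre the triples over their classes; a fibre injects into the `B_M` of its class
(`tripleShapes_mem_shapeTriples`, `eq_of_tripleClass_eq`), whose data are admissible at a scale
`C₀ = 2^k ≤ c ≤ X` (`admissible_of_triple`). [cite: BernertEtAl2024, Proposition 2.1] -/
theorem abcExponentCount_le_of_shapeCount_le {ε : ℝ} (hε : 0 < ε) (hε2 : ε < 1 / 2) {l : ℝ}
    (hl : 0 ≤ l) {θ K : ℝ} (hθ : 0 ≤ θ) (hK : 0 ≤ K)
    (hB : ∀ (C₀ c₁ c₂ c₃ : ℕ) (X Y Z : Fin (numShapes ε) → ℕ),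
      Admissible l ε C₀ c₁ c₂ c₃ X Y Z → (shapeCount c₁ c₂ c₃ X Y Z : ℝ) ≤ K * (C₀ : ℝ) ^ θ)
    (X : ℕ) :
    (abcExponentCount l X : ℝ) ≤ K * (classRange ε X).card * (X : ℝ) ^ θ := by
  classical
  set H := (abcExponentCount_finite l X).toFinset with hH
  have hmem : ∀ t ∈ H, IsABCTriple t.1 t.2.1 t.2.2 ∧ t.2.2 ≤ X ∧
      ((rad t.1 t.2.1 t.2.2 : ℕ) : ℝ) < (t.2.2 : ℝ) ^ l := by
    intro t ht
    simpa [hH, Set.Finite.mem_toFinset] using ht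
  have hmaps : Set.MapsTo (tripleClass ε) (H : Set _) (classRange ε X : Set _) := fun t ht =>
    mem_coe.mpr (tripleClass_mem_classRange hε hε2 (hmem t (mem_coe.mp ht)).1
      (hmem t (mem_coe.mp ht)).2.1)
  have hXθ : 0 ≤ K * (X : ℝ) ^ θ := by positivity
  have hfib : ∀ q ∈ classRange ε X,
      ((H.filter (fun t => tripleClass ε t = q)).card : ℝ) ≤ K * (X : ℝ) ^ θ := by
    rintro ⟨k, ⟨c₁, c₂, c₃⟩, ⟨eX, eY, eZ⟩⟩ -
    rcases (H.filter (fun t => tripleClass ε t = (k, (c₁, c₂, c₃), (eX, eY, eZ)))).eq_empty_or_nonempty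
      with he | ⟨t₀, ht₀⟩
    · rw [he, card_empty, Nat.cast_zero]; exact hXθ
    obtain ⟨ht₀H, hq₀⟩ := mem_filter.mp ht₀
    obtain ⟨htr₀, hcX₀, hrad₀⟩ := hmem t₀ ht₀H
    obtain ⟨hadm, hC₀c⟩ := admissible_of_triple hε hε2 hl htr₀ hrad₀ hq₀
    have h1 : (H.filter (fun t => tripleClass ε t = (k, (c₁, c₂, c₃), (eX, eY, eZ)))).card ≤
        shapeCount c₁ c₂ c₃ (classBox eX) (classBox eY) (classBox eZ) := by
      rw [shapeCount]
      refine card_le_card_of_injOn (tripleShapes ε) (fun t ht => ?_) (fun t ht t' ht' h => ?_)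
      · obtain ⟨htH, hq⟩ := mem_filter.mp (mem_coe.mp ht)
        exact mem_coe.mpr (tripleShapes_mem_shapeTriples hε hε2 (hmem t htH).1 hq)
      · obtain ⟨htH, hq⟩ := mem_filter.mp (mem_coe.mp ht)
        obtain ⟨htH', hq'⟩ := mem_filter.mp (mem_coe.mp ht')
        exact eq_of_tripleClass_eq hε hε2 (hmem t htH).1 (hmem t' htH').1 (hq.trans hq'.symm) h
    have h2 := hB _ _ _ _ _ _ _ hadm
    have h3 : (((2 ^ k : ℕ) : ℝ)) ^ θ ≤ (X : ℝ) ^ θ :=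
      Real.rpow_le_rpow (by positivity) (by exact_mod_cast hC₀c.trans hcX₀) hθ
    calc (((H.filter (fun t => tripleClass ε t = (k, (c₁, c₂, c₃), (eX, eY, eZ)))).card : ℕ) : ℝ)
        ≤ (shapeCount c₁ c₂ c₃ (classBox eX) (classBox eY) (classBox eZ) : ℝ) := by
          exact_mod_cast h1
      _ ≤ K * ((2 ^ k : ℕ) : ℝ) ^ θ := h2
      _ ≤ K * (X : ℝ) ^ θ := mul_le_mul_of_nonneg_left h3 hK
  calc (abcExponentCount l X : ℝ) = (H.card : ℝ) := by
        rw [abcExponentCount, Set.ncard_eq_toFinset_card _ (abcExponentCount_finite l X)]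
    _ = ∑ q ∈ classRange ε X, ((H.filter (fun t => tripleClass ε t = q)).card : ℝ) := by
        rw [card_eq_sum_card_fiberwise hmaps]; push_cast; rfl
    _ ≤ ∑ q ∈ classRange ε X, K * (X : ℝ) ^ θ := sum_le_sum hfib
    _ = K * (classRange ε X).card * (X : ℝ) ^ θ := by rw [sum_const, nsmul_eq_mul]; ring

/-! ### The number of classes is `X^{o(1)}` -/

/-- `⌊log₂ X⌋ + 1 ≤ 2 log X / log 2` for `X ≥ 2`. [folklore] -/
theorem natLog_two_add_one_le {X : ℕ} (hX : 2 ≤ X) :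
    ((Nat.log 2 X + 1 : ℕ) : ℝ) ≤ 2 * Real.log X / Real.log 2 := by
  have hlog2 : 0 < Real.log 2 := Real.log_pos one_lt_two
  have hL1 : 1 ≤ Nat.log 2 X := Nat.le_log_of_pow_le one_lt_two (by simpa using hX)
  have hLX : ((Nat.log 2 X : ℕ) : ℝ) * Real.log 2 ≤ Real.log X := by
    have h1 : ((2 ^ Nat.log 2 X : ℕ) : ℝ) ≤ X := by
      exact_mod_cast Nat.pow_log_le_self 2 (by omega : X ≠ 0)
    have h2 : Real.log ((2 ^ Nat.log 2 X : ℕ) : ℝ) ≤ Real.log X :=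
      Real.log_le_log (by positivity) h1
    rwa [Nat.cast_pow, Nat.cast_ofNat, Real.log_pow] at h2
  rw [le_div_iff₀ hlog2]
  push_cast
  have : (1 : ℝ) ≤ Nat.log 2 X := by exact_mod_cast hL1
  nlinarith

/-- **The number of classes is small**: for `δ > 0` there is `C` with
`#classRange ε X ≤ C · X^{3ε/2 + δ}` for all `X ≥ 2` (`⌊X^{ε/2}⌋³ ≤ X^{3ε/2}` and
`(⌊log₂ X⌋ + 1)^{3M+1} ≤ (2 log X/log 2)^{3M+1} ≪_δ X^δ`). [folklore] -/
theorem card_classRange_le (ε : ℝ) {δ : ℝ} (hδ : 0 < δ) :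
    ∃ C : ℝ, 0 < C ∧ ∀ X : ℕ, 2 ≤ X →
      ((classRange ε X).card : ℝ) ≤ C * (X : ℝ) ^ (3 * ε / 2 + δ) := by
  set M := numShapes ε with hM
  set m : ℕ := 3 * M + 1 with hm
  set η : ℝ := δ / m with hη
  have hm0 : (0 : ℝ) < m := by rw [hm]; positivity
  have hη0 : 0 < η := by positivity
  have hlog2 : 0 < Real.log 2 := Real.log_pos one_lt_two
  set A : ℝ := 2 / (Real.log 2 * η) with hA
  have hA0 : 0 < A := by positivity
  refine ⟨A ^ m, by positivity, fun X hX => ?_⟩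
  have hX0 : (0 : ℝ) < X := by exact_mod_cast (by omega : 0 < X)
  have hX1 : (1 : ℝ) ≤ X := by exact_mod_cast (by omega : 1 ≤ X)
  rw [card_classRange]
  -- the logarithmic factor
  have hL : ((Nat.log 2 X + 1 : ℕ) : ℝ) ≤ A * (X : ℝ) ^ η := by
    refine (natLog_two_add_one_le hX).trans ?_
    have h1 : Real.log X ≤ (X : ℝ) ^ η / η := Real.log_le_rpow_div hX0.le hη0
    rw [hA]
    rw [div_le_iff₀ hlog2] at *
    calc 2 * Real.log X ≤ 2 * ((X : ℝ) ^ η / η) := by linarith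
      _ = 2 / (Real.log 2 * η) * (X : ℝ) ^ η * Real.log 2 := by field_simp
  have hLm : (((Nat.log 2 X + 1) ^ m : ℕ) : ℝ) ≤ A ^ m * (X : ℝ) ^ δ := by
    push_cast
    calc ((Nat.log 2 X : ℝ) + 1) ^ m ≤ (A * (X : ℝ) ^ η) ^ m := by
          exact pow_le_pow_left₀ (by positivity) (by exact_mod_cast hL) m
      _ = A ^ m * ((X : ℝ) ^ η) ^ m := mul_pow _ _ _
      _ = A ^ m * (X : ℝ) ^ δ := by
          rw [← Real.rpow_mul_natCast hX0.le, hη, div_mul_cancel₀ _ hm0.ne']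
  -- the cofactor factor
  have hF : ((⌊(X : ℝ) ^ (ε / 2)⌋₊ ^ 3 : ℕ) : ℝ) ≤ (X : ℝ) ^ (3 * ε / 2) := by
    push_cast
    calc (⌊(X : ℝ) ^ (ε / 2)⌋₊ : ℝ) ^ 3 ≤ ((X : ℝ) ^ (ε / 2)) ^ 3 :=
          pow_le_pow_left₀ (by positivity) (Nat.floor_le (by positivity)) 3
      _ = (X : ℝ) ^ (3 * ε / 2) := by
          rw [← Real.rpow_mul_natCast hX0.le]; congr 1; push_cast; ring
  -- assemble
  have hsplit : (((Nat.log 2 X + 1) * ⌊(X : ℝ) ^ (ε / 2)⌋₊ ^ 3 * (Nat.log 2 X + 1) ^ (3 * M) : ℕ) : ℝ)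
      = (((Nat.log 2 X + 1) ^ m : ℕ) : ℝ) * ((⌊(X : ℝ) ^ (ε / 2)⌋₊ ^ 3 : ℕ) : ℝ) := by
    rw [hm]; push_cast; ring
  rw [hsplit]
  calc (((Nat.log 2 X + 1) ^ m : ℕ) : ℝ) * ((⌊(X : ℝ) ^ (ε / 2)⌋₊ ^ 3 : ℕ) : ℝ)
      ≤ (A ^ m * (X : ℝ) ^ δ) * (X : ℝ) ^ (3 * ε / 2) :=
        mul_le_mul hLm hF (by positivity) (by positivity)
    _ = A ^ m * (X : ℝ) ^ (3 * ε / 2 + δ) := by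
        rw [Real.rpow_add hX0]; ring

end AbcShapes

end Literature.NumberTheory.DiophantineGeometry
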